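import Literature.NumberTheory.LFunctions.EisensteinGrossencharacterEuler
import HarnessLib

/-!
# The cubic Gauss sums `g(π) = Σ_{d (mod π)} (d/π)₃ e(d/π)` of `ℤ[ω]` at primes:
# definition, `|g(π)|² = N(π)`, and `g(π̄) = conj g(π)`

Topic `NumberTheory/GaussSums`; namespace `Literature.NumberTheory.GaussSums`, grouping
sub-namespace `HeathBrownPatterson` (the objects of Heath-Brown–Patterson's paper). Definitions
WITH BODIES and proved theorems only; no named fact.

Source (READ, open-access GDZ scan, EuDML 152154): D. R. Heath-Brown, S. J. Patterson, *The
distribution of Kummer sums at prime arguments*, J. reine angew. Math. 310 (1979) 111–130, p. 111: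
"Let `ω = e^{2πi/3}` and let `(·/·)₃` be the cubic residue symbol in `ℚ(ω)`. For `c ∈ ℤ[ω]`,
`c ≡ 1 (3)` the cubic Gauss sum `g(c)` is defined by `g(c) = Σ_{d (mod c), (c,d)=1} (d/c)₃ e(d/c)`
where, for `z ∈ ℂ`, `e(z) = exp(2πi(z + z̄))`. It is well known that (cf. [5] pp. 443–445)
`g(c)³ = μ(c) c² c̄` … In particular, if `c` is square-free `|g(c)| = |c|`. Now let `N` be the norm of
`ℚ(ω)/ℚ` and define `g̃(c) = g(c)/N(c)^{1/2}` …"; p. 115: "`g(c̄) = conj g(c)`".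

These are the objects of the paper's Theorem 1 (p. 112; prime form §2 p. 115):
`Σ_{N(π) ≤ X, π prime ≡ 1 (3)} g̃(π) (π̄/|π|)^l ≪ X^ε (X^{30/31} + |l| X^{29/31})` — the input of the
uniform distribution of `arg g̃(π)` (Theorem 2) and of Kummer's three classes
(`KummerClassesEquidistribution*`). That theorem rests on Kubota–Patterson's cubic theta function
and is NOT vendored here (a provefact seat may not mint facts, D-0026); it enters the tree as the
hypothesis `hT1` of the bridge theorem in `KummerClassesEquidistributionHBPProofs`. This file supplies
the definitions it is stated in, and the two elementary properties the bridge needs at ALL primes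
`π ∤ 3` (split or inert):

* `e`, `cubicSymbol`, `gaussTerm`, `gauss`, `gaussTilde`, `primaryPrimesUpTo` (verbatim renderings,
  see the docstrings; `gaussTerm_add_mul`: the summand depends only on `d mod π`);
* the residue field `𝓞 K3 ⧸ (π)` of a prime `π ∤ 3`, the cubic character `chi` (the tree's
  `cubicResidueChar`, Ireland–Rosen Ch. 9 §3, read in `ℂ`) and the additive character `psi`
  (`d ↦ e(d/π)`) on it, with `gauss π = gaussSum (chi …) (psi …)` (`gauss_eq_gaussSum`),
  `chi ≠ 1`, `psi` primitive (`psi_ne_one`: `e(1/π) = e(ζ/π) = 1` would force `N(π) ∣ 9`);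
* **`‖gauss π‖² = N(π)`** (`norm_gauss_sq`, from Mathlib's `gaussSum_mul_gaussSum_eq_card` and
  `gaussSum chi⁻¹ psi⁻¹ = conj (gaussSum chi psi)`), hence **`‖gaussTilde π‖ = 1`**;
* **`gauss (τ π) = conj (gauss π)`** for the conjugation `τ` of `ℤ[ω]` (`gauss_tau`: naturality of
  the cubic residue symbol, `cubicResidueSymbol_conjPrime`, and `e(z̄) = e(z)`, `e(−z) = conj e(z)`).

## References

* D. R. Heath-Brown, S. J. Patterson, J. reine angew. Math. 310 (1979) 111–130, p. 111, p. 115.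
  [cite: HeathBrownPatterson1979, §1 p.111]
* K. Ireland, M. Rosen, *A Classical Introduction to Modern Number Theory*, GTM 84, Ch. 8 §2
  (Prop. 8.2.2: `|g(χ)| = √p`), Ch. 9 §3. [cite: IrelandRosen1990, Prop. 8.2.2]

## Mathlib / tree search

Tree: `EisensteinField*` (`K3`, `mkInt`, `exists_eq_mkInt`, `mkInt_mul_conj`), `EisensteinGrossencharacterSums`
(`embC`, `embC_mkInt`, `w_re`, `w_im`, `intBox`, `mem_intBox_of_absNorm_le`, `absNorm_span_singleton_eq`, `hζ`,
`three`), `EisensteinGrossencharacterEuler` (`primeOf`, `tau`, `embC_tau`, `coe_tau`, `conjPrime`,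
`conjPrime_primeOf`, `cubicResidueSymbol_conjPrime`, `map_tau_span`), `CubicResidueSymbol`
(`cubicResidueSymbol`, `cubicResidueChar`, `cubicResidueSymbol_spec`, `three_dvd_residueCard_sub_one`,
`residueCard_sub_one_div_three_ne_zero`). Mathlib: `gaussSum`, `gaussSum_mul_gaussSum_eq_card`,
`mul_gaussSum_inv_eq_gaussSum`, `AddChar.IsPrimitive.of_ne_one`, `MulChar.inv_apply_eq_inv'`,
`Complex.inv_eq_conj`, `Ideal.Quotient.mk_out`, `Ideal.quotientEquiv`, `Ideal.finiteQuotientOfFreeOfNeBot`,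
`finsum_eq_sum_of_fintype`, `Complex.exp_eq_one_iff`.
-/

noncomputable section

open NumberField IsDedekindDomain Complex Finset
open scoped ComplexConjugate

namespace Literature.NumberTheory.GaussSums

open Literature.NumberTheory.NumberFields Literature.NumberTheory.NumberFields.K3
open Literature.NumberTheory.GaloisRepresentations
open Literature.NumberTheory.LFunctions.EisensteinGrossen

namespace HeathBrownPatterson

/-! ### The definitions (Heath-Brown–Patterson 1979, p. 111) -/

/-- `e(z) = exp(2πi (z + z̄))` for `z ∈ ℚ(ω) ⊂ ℂ` (embedded by `embC : ζ ↦ e^{2πi/3}`); note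
`z + z̄ = Tr_{ℚ(ω)/ℚ}(z)`. [cite: HeathBrownPatterson1979, p.111] -/
def e (z : K3) : ℂ :=
  Complex.exp (2 * Real.pi * Complex.I * (embC z + conj (embC z)))

/-- The cubic residue symbol `(d/π)₃ ∈ {0, 1, ω, ω²} ⊂ ℂ` for a PRIME element `π` of `ℤ[ω] = 𝓞 K3`
(the tree's `cubicResidueSymbol` at the place `(π)`, read in `ℂ` through `embC`), as a function of
`d ∈ ℤ[ω]`; junk value `0` when `(π)` is not a non-zero prime ideal.
[cite: HeathBrownPatterson1979, p.111; IrelandRosen1990, Ch. 9 §3] -/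
def cubicSymbol (π d : 𝓞 K3) : ℂ :=
  haveI := Classical.propDecidable
  if h : (Ideal.span ({π} : Set (𝓞 K3))).IsPrime ∧ Ideal.span ({π} : Set (𝓞 K3)) ≠ ⊥ then
    embC (((cubicResidueSymbol (K := K3) ⟨Ideal.span {π}, h.1, h.2⟩
      (Ideal.Quotient.mk (Ideal.span {π}) d) : 𝓞 K3) : K3))
  else 0

/-- The summand `(d/π)₃ e(d/π)` of the cubic Gauss sum. [cite: HeathBrownPatterson1979, p.111] -/
def gaussTerm (π d : 𝓞 K3) : ℂ :=
  cubicSymbol π d * e (((d : 𝓞 K3) : K3) / ((π : 𝓞 K3) : K3))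

/-- **The cubic Gauss sum `g(π) = Σ_{d (mod π)} (d/π)₃ e(d/π)`** of a prime `π ≡ 1 (3)` of `ℤ[ω]`
(sum over the residue classes `x` modulo `π`, each evaluated at a representative `Quotient.out x`; the
summand only depends on the class, `gaussTerm_add_mul`). Total in `π` (a `finsum`; the quotient is
finite for `π ≠ 0`, and the symbol is the junk `0` unless `(π)` is a non-zero prime).
[cite: HeathBrownPatterson1979, p.111] -/
def gauss (π : 𝓞 K3) : ℂ :=
  ∑ᶠ x : 𝓞 K3 ⧸ Ideal.span ({π} : Set (𝓞 K3)), gaussTerm π (Quotient.out x)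

/-- **The normalised cubic Gauss sum `g̃(π) = g(π)/N(π)^{1/2}`.** [cite: HeathBrownPatterson1979, p.111] -/
def gaussTilde (π : 𝓞 K3) : ℂ :=
  gauss π / (Real.sqrt (Ideal.absNorm (Ideal.span ({π} : Set (𝓞 K3))) : ℝ) : ℂ)

open Classical in
/-- The primes `π` of `ℤ[ω]` with `π ≡ 1 (mod 3)` and `N(π) ≤ X` (the range "`N(π) ≤ X`, `π` prime,
`π ≡ 1 (3)`" of [cite: HeathBrownPatterson1979, §2 p.115]), as a `Finset`. -/
def primaryPrimesUpTo (X : ℕ) : Finset (𝓞 K3) :=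
  (intBox (X + 1)).filter
    (fun π ↦ Prime π ∧ π - 1 ∈ three ∧ Ideal.absNorm (Ideal.span ({π} : Set (𝓞 K3))) ≤ X)

open Classical in
/-- Membership in `primaryPrimesUpTo X`: `π` prime, `π ≡ 1 (mod 3)`, `N(π) ≤ X`. [folklore] -/
theorem mem_primaryPrimesUpTo {X : ℕ} {π : 𝓞 K3} :
    π ∈ primaryPrimesUpTo X ↔
      Prime π ∧ π - 1 ∈ three ∧ Ideal.absNorm (Ideal.span ({π} : Set (𝓞 K3))) ≤ X := by
  rw [primaryPrimesUpTo, Finset.mem_filter]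
  exact ⟨fun h ↦ h.2, fun h ↦ ⟨mem_intBox_of_absNorm_le h.2.2, h⟩⟩

/-! ### Basic properties of `e` -/

/-- `embC z + conj (embC z)` is the real number `2 Re (embC z)`. [folklore] -/
theorem embC_add_conj (z : K3) : embC z + conj (embC z) = ((2 * (embC z).re : ℝ) : ℂ) := by
  apply Complex.ext
  · simp; ring
  · simp

/-- `e(z) = exp(2πi · 2 Re z)`: an exponential of a purely imaginary number. [folklore] -/
theorem e_eq_exp_ofReal (z : K3) :
    e z = Complex.exp (((2 * Real.pi * (2 * (embC z).re) : ℝ) : ℂ) * Complex.I) := by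
  unfold e
  rw [embC_add_conj]
  congr 1
  push_cast
  ring

/-- `‖e(z)‖ = 1`. [folklore] -/
theorem norm_e (z : K3) : ‖e z‖ = 1 := by
  rw [e_eq_exp_ofReal, Complex.norm_exp_ofReal_mul_I]

/-- `e(z + z') = e(z) e(z')`. [folklore] -/
theorem e_add (z z' : K3) : e (z + z') = e z * e z' := by
  unfold e
  rw [← Complex.exp_add, map_add, map_add]
  congr 1
  ring

/-- `e(−z) = conj e(z)` (`e(z)` has modulus one). [folklore] -/
theorem e_neg (z : K3) : e (-z) = conj (e z) := by
  rw [e_eq_exp_ofReal, e_eq_exp_ofReal, ← Complex.exp_conj, map_mul, Complex.conj_ofReal,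
    Complex.conj_I, map_neg, Complex.neg_re]
  congr 1
  push_cast
  ring

/-- `e(z̄) = e(z)` (`e` only sees `z + z̄`). [folklore] -/
theorem e_star (z : K3) : e (star z) = e z := by
  unfold e
  rw [embC_star, Complex.conj_conj, add_comm]

/-- `e(z + m) = e(z)` for `m ∈ ℤ[ω]`: `m + m̄ = 2a − b ∈ ℤ` for `m = a + bζ`. [folklore] -/
theorem e_add_intCoord (z : K3) (m : 𝓞 K3) : e (z + (m : K3)) = e z := by
  obtain ⟨a, b, rfl⟩ := exists_eq_mkInt m
  have hm : embC ((mkInt a b : 𝓞 K3) : K3) + conj (embC ((mkInt a b : 𝓞 K3) : K3)) =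
      ((2 * a - b : ℤ) : ℂ) := by
    rw [embC_mkInt]
    apply Complex.ext
    · simp [w_re]; ring
    · simp [w_im]
  rw [e_add]
  have h1 : e ((mkInt a b : 𝓞 K3) : K3) = 1 := by
    unfold e
    rw [hm, show (2 * Real.pi * Complex.I * ((2 * a - b : ℤ) : ℂ)) =
        ((2 * a - b : ℤ) : ℂ) * (2 * Real.pi * Complex.I) by ring]
    exact Complex.exp_int_mul_two_pi_mul_I (2 * a - b)
  rw [h1, mul_one]

/-- `e(d/π)` only depends on `d mod π`. [folklore] -/
theorem e_div_add_mul (π d m : 𝓞 K3) :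
    e ((((d + m * π : 𝓞 K3) : 𝓞 K3) : K3) / ((π : 𝓞 K3) : K3)) =
      e (((d : 𝓞 K3) : K3) / ((π : 𝓞 K3) : K3)) := by
  by_cases hπ : π = 0
  · subst hπ; simp
  · have hπ' : ((π : 𝓞 K3) : K3) ≠ 0 := fun h ↦ hπ (RingOfIntegers.coe_eq_zero_iff.mp h)
    have hcoe : (((d + m * π : 𝓞 K3) : 𝓞 K3) : K3) =
        ((d : 𝓞 K3) : K3) + ((m : 𝓞 K3) : K3) * ((π : 𝓞 K3) : K3) := by
      push_cast; ring
    rw [hcoe, add_div, mul_div_cancel_right₀ _ hπ', e_add_intCoord]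

/-- The Gauss summand only depends on `d mod π`: `(·/π)₃` is a function on `𝓞 K3 ⧸ (π)` and
`e((d + mπ)/π) = e(d/π + m) = e(d/π)`. [folklore] -/
theorem gaussTerm_add_mul (π d m : 𝓞 K3) : gaussTerm π (d + m * π) = gaussTerm π d := by
  unfold gaussTerm
  have hsym : cubicSymbol π (d + m * π) = cubicSymbol π d := by
    unfold cubicSymbol
    split_ifs with h
    · have hq : Ideal.Quotient.mk (Ideal.span ({π} : Set (𝓞 K3))) (d + m * π) =
          Ideal.Quotient.mk (Ideal.span ({π} : Set (𝓞 K3))) d := by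
        rw [Ideal.Quotient.eq]
        simpa using Ideal.mul_mem_left _ m (Ideal.mem_span_singleton_self π)
      rw [hq]
    · rfl
  rw [hsym, e_div_add_mul]

/-! ### The residue field of a prime `π ∤ 3` and the two characters -/

section Prime

variable {π : 𝓞 K3}

/-- A prime `π ≡ 1 (mod 3)` does not divide `3`. [folklore] -/
theorem three_not_mem_span_of_sub_one_mem (hπ : Prime π) (hπ1 : π - 1 ∈ three) :
    (3 : 𝓞 K3) ∉ Ideal.span ({π} : Set (𝓞 K3)) := by
  intro h
  have h1 : π - 1 ∈ Ideal.span ({π} : Set (𝓞 K3)) := by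
    have hle : three ≤ Ideal.span ({π} : Set (𝓞 K3)) := by
      rw [three, Ideal.span_singleton_le_iff_mem]; exact h
    exact hle hπ1
  have hone : (1 : 𝓞 K3) ∈ Ideal.span ({π} : Set (𝓞 K3)) := by
    have := Ideal.sub_mem _ (Ideal.mem_span_singleton_self π) h1
    rwa [sub_sub_cancel] at this
  exact hπ.not_unit (isUnit_of_dvd_one (Ideal.mem_span_singleton.mp hone))

/-- `cubicSymbol π d = embC (χ_{(π)}(d))` for a prime `π`. [folklore] -/
theorem cubicSymbol_eq (hπ : Prime π) (d : 𝓞 K3) :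
    cubicSymbol π d =
      embC ((cubicResidueSymbol (primeOf hπ) (Ideal.Quotient.mk (primeOf hπ).asIdeal d) : 𝓞 K3) : K3) := by
  unfold cubicSymbol
  rw [dif_pos ⟨(primeOf hπ).isPrime, (primeOf hπ).ne_bot⟩]
  rfl

/-- The residue ring modulo a non-zero prime is finite. [folklore] -/
instance finite_quotient_span (π : 𝓞 K3) [hne : NeZero π] :
    Finite (𝓞 K3 ⧸ Ideal.span ({π} : Set (𝓞 K3))) :=
  Ideal.finiteQuotientOfFreeOfNeBot _ (by rw [Ne, Ideal.span_singleton_eq_bot]; exact hne.out)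

/-- **The cubic character `χ_π = (·/π)₃` of the residue field `𝓞 K3 ⧸ (π)`, with complex values**
(the tree's `cubicResidueChar`, composed with `embC`). [cite: IrelandRosen1990, Ch. 9 §3 Prop. 9.3.3] -/
def chi (hπ : Prime π) (hπ3 : (3 : 𝓞 K3) ∉ Ideal.span ({π} : Set (𝓞 K3))) :
    MulChar (𝓞 K3 ⧸ Ideal.span ({π} : Set (𝓞 K3))) ℂ :=
  (cubicResidueChar hζ (primeOf hπ) hπ3).ringHomComp
    ((embC : K3 →ₐ[ℚ] ℂ).toRingHom.comp (algebraMap (𝓞 K3) K3))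

/-- `chi` is the cubic residue symbol read in `ℂ`. [folklore] -/
theorem chi_apply (hπ : Prime π) (hπ3 : (3 : 𝓞 K3) ∉ Ideal.span ({π} : Set (𝓞 K3))) (x : 𝓞 K3 ⧸ Ideal.span ({π} : Set (𝓞 K3))) :
    chi hπ hπ3 x = embC ((cubicResidueSymbol (primeOf hπ) x : 𝓞 K3) : K3) := rfl

/-- `chi (mk d) = cubicSymbol π d`. [folklore] -/
theorem chi_mk (hπ : Prime π) (hπ3 : (3 : 𝓞 K3) ∉ Ideal.span ({π} : Set (𝓞 K3))) (d : 𝓞 K3) :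
    chi hπ hπ3 (Ideal.Quotient.mk (Ideal.span ({π} : Set (𝓞 K3))) d) = cubicSymbol π d := by
  rw [chi_apply, cubicSymbol_eq hπ]; rfl

/-- The values of `chi` are `0` or cube roots of unity; in particular `‖chi x‖ ≤ 1` and
`(chi x)⁻¹ = conj (chi x)`. [folklore] -/
theorem chi_eq_zero_or_pow_three (hπ : Prime π) (hπ3 : (3 : 𝓞 K3) ∉ Ideal.span ({π} : Set (𝓞 K3))) (x : 𝓞 K3 ⧸ Ideal.span ({π} : Set (𝓞 K3))) :
    chi hπ hπ3 x = 0 ∨ chi hπ hπ3 x ^ 3 = 1 := by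
  rw [chi_apply]
  rcases cubicResidueSymbol_eq_zero_or_pow_three hζ (primeOf hπ) x with h | h
  · left; rw [h]; simp
  · right
    rw [← map_pow, show ((cubicResidueSymbol (primeOf hπ) x : 𝓞 K3) : K3) ^ 3 =
      (((cubicResidueSymbol (primeOf hπ) x) ^ 3 : 𝓞 K3) : K3) from
        (map_pow (algebraMap (𝓞 K3) K3) _ 3).symm, h]
    simp

/-- `‖chi x‖ = 1` unless `chi x = 0`. [folklore] -/
theorem norm_chi_eq_one_of_ne_zero (hπ : Prime π) (hπ3 : (3 : 𝓞 K3) ∉ Ideal.span ({π} : Set (𝓞 K3))) {x : 𝓞 K3 ⧸ Ideal.span ({π} : Set (𝓞 K3))}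
    (hx : chi hπ hπ3 x ≠ 0) : ‖chi hπ hπ3 x‖ = 1 := by
  rcases chi_eq_zero_or_pow_three hπ hπ3 x with h | h
  · exact absurd h hx
  · have : ‖chi hπ hπ3 x‖ ^ 3 = 1 := by rw [← norm_pow, h, norm_one]
    exact (pow_eq_one_iff_of_nonneg (norm_nonneg _) (by norm_num)).mp this

/-- `‖chi x‖ ≤ 1`. [folklore] -/
theorem norm_chi_le (hπ : Prime π) (hπ3 : (3 : 𝓞 K3) ∉ Ideal.span ({π} : Set (𝓞 K3))) (x : 𝓞 K3 ⧸ Ideal.span ({π} : Set (𝓞 K3))) : ‖chi hπ hπ3 x‖ ≤ 1 := by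
  by_cases hx : chi hπ hπ3 x = 0
  · rw [hx, norm_zero]; exact zero_le_one
  · exact (norm_chi_eq_one_of_ne_zero hπ hπ3 hx).le

/-- `chi⁻¹ x = conj (chi x)`. [folklore] -/
theorem chi_inv_apply (hπ : Prime π) (hπ3 : (3 : 𝓞 K3) ∉ Ideal.span ({π} : Set (𝓞 K3))) (x : 𝓞 K3 ⧸ Ideal.span ({π} : Set (𝓞 K3))) :
    (chi hπ hπ3)⁻¹ x = conj (chi hπ hπ3 x) := by
  rw [MulChar.inv_apply_eq_inv']
  by_cases hx : chi hπ hπ3 x = 0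
  · rw [hx, inv_zero, map_zero]
  · exact Complex.inv_eq_conj (norm_chi_eq_one_of_ne_zero hπ hπ3 hx)

/-- `chi` is non-trivial: a generator `g` of the cyclic group `(𝓞 K3 ⧸ π)ˣ` has
`g^{(N(π)−1)/3} ≠ 1`. [cite: IrelandRosen1990, Ch. 9 §3 Prop. 9.3.3] -/
theorem chi_ne_one (hπ : Prime π) (hπ3 : (3 : 𝓞 K3) ∉ Ideal.span ({π} : Set (𝓞 K3))) : chi hπ hπ3 ≠ 1 := by
  haveI : (Ideal.span ({π} : Set (𝓞 K3))).IsMaximal := (primeOf hπ).isMaximal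
  letI := Ideal.Quotient.field (Ideal.span ({π} : Set (𝓞 K3)))
  haveI : NeZero π := ⟨hπ.ne_zero⟩
  letI : Fintype (𝓞 K3 ⧸ Ideal.span ({π} : Set (𝓞 K3))) := Fintype.ofFinite _
  classical
  intro h1
  obtain ⟨g, hg⟩ := IsCyclic.exists_generator (α := (𝓞 K3 ⧸ Ideal.span ({π} : Set (𝓞 K3)))ˣ)
  have hval : chi hπ hπ3 (g : 𝓞 K3 ⧸ Ideal.span ({π} : Set (𝓞 K3))) = 1 := by
    rw [h1, MulChar.one_apply_coe]
  have hsym : cubicResidueSymbol (primeOf hπ) (g : 𝓞 K3 ⧸ Ideal.span ({π} : Set (𝓞 K3))) = 1 := by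
    rw [chi_apply] at hval
    have hinj : Function.Injective (fun y : 𝓞 K3 ↦ embC ((y : 𝓞 K3) : K3)) :=
      fun a b hab ↦ RingOfIntegers.ext (embC_injective hab)
    exact hinj (by simpa using hval)
  have hspec := (cubicResidueSymbol_spec hζ hπ3 (𝔭 := primeOf hπ) (Units.ne_zero g)).2
  rw [hsym, map_one] at hspec
  have hord : orderOf g = Fintype.card (𝓞 K3 ⧸ Ideal.span ({π} : Set (𝓞 K3))) - 1 := by
    rw [orderOf_eq_card_of_forall_mem_zpowers hg, Nat.card_eq_fintype_card, Fintype.card_units]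
  have hcardF : Fintype.card (𝓞 K3 ⧸ Ideal.span ({π} : Set (𝓞 K3))) = (primeOf hπ).residueCard := by
    rw [HeightOneSpectrum.residueCard_eq_card_quotient]
    exact Nat.card_eq_fintype_card.symm
  have hspec' : ((g : (𝓞 K3 ⧸ Ideal.span ({π} : Set (𝓞 K3)))ˣ) : 𝓞 K3 ⧸ Ideal.span ({π} : Set (𝓞 K3))) ^
      (((primeOf hπ).residueCard - 1) / 3) = 1 := hspec.symm
  have hdvd := orderOf_dvd_of_pow_eq_one (x := g) (n := ((primeOf hπ).residueCard - 1) / 3)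
    (Units.ext (by rw [Units.val_pow_eq_pow_val, Units.val_one]; exact hspec'))
  rw [hord, hcardF] at hdvd
  have hpos := residueCard_sub_one_div_three_ne_zero hζ hπ3 (𝔭 := primeOf hπ)
  have h3dvd := three_dvd_residueCard_sub_one hζ hπ3 (𝔭 := primeOf hπ)
  have hle := Nat.le_of_dvd (Nat.pos_of_ne_zero hpos) hdvd
  omega

/-- `e(out x / π)` as a function on the residue classes. [folklore] -/
def eQuot (π : 𝓞 K3) (x : 𝓞 K3 ⧸ Ideal.span ({π} : Set (𝓞 K3))) : ℂ :=
  e (((Quotient.out x : 𝓞 K3) : K3) / ((π : 𝓞 K3) : K3))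

/-- `eQuot π (mk d) = e(d/π)`. [folklore] -/
theorem eQuot_mk (π d : 𝓞 K3) :
    eQuot π (Ideal.Quotient.mk (Ideal.span ({π} : Set (𝓞 K3))) d) =
      e (((d : 𝓞 K3) : K3) / ((π : 𝓞 K3) : K3)) := by
  unfold eQuot
  set x := Ideal.Quotient.mk (Ideal.span ({π} : Set (𝓞 K3))) d with hx
  have hout : Ideal.Quotient.mk (Ideal.span ({π} : Set (𝓞 K3))) (Quotient.out x) = x :=
    Ideal.Quotient.mk_out x
  rw [hx, Ideal.Quotient.eq, Ideal.mem_span_singleton'] at hout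
  obtain ⟨m, hm⟩ := hout
  have : Quotient.out x = d + m * π := by rw [hm]; ring
  rw [this, e_div_add_mul]

/-- **The additive character `ψ_π : d ↦ e(d/π)` of `𝓞 K3 ⧸ (π)`.** [cite: HeathBrownPatterson1979, p.111] -/
def psi (π : 𝓞 K3) : AddChar (𝓞 K3 ⧸ Ideal.span ({π} : Set (𝓞 K3))) ℂ where
  toFun := eQuot π
  map_zero_eq_one' := by
    rw [← (Ideal.Quotient.mk (Ideal.span ({π} : Set (𝓞 K3)))).map_zero, eQuot_mk]
    simp [e]
  map_add_eq_mul' x y := by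
    obtain ⟨a, rfl⟩ := Ideal.Quotient.mk_surjective x
    obtain ⟨b, rfl⟩ := Ideal.Quotient.mk_surjective y
    rw [← map_add, eQuot_mk, eQuot_mk, eQuot_mk]
    push_cast
    rw [add_div, e_add]

/-- `psi π (mk d) = e(d/π)`. [folklore] -/
theorem psi_mk (π d : 𝓞 K3) :
    psi π (Ideal.Quotient.mk (Ideal.span ({π} : Set (𝓞 K3))) d) =
      e (((d : 𝓞 K3) : K3) / ((π : 𝓞 K3) : K3)) :=
  eQuot_mk π d

/-- `psi π x = e(out x / π)` (definitional). [folklore] -/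
theorem psi_apply_eq (π : 𝓞 K3) (x : 𝓞 K3 ⧸ Ideal.span ({π} : Set (𝓞 K3))) :
    psi π x = e (((Quotient.out x : 𝓞 K3) : K3) / ((π : 𝓞 K3) : K3)) := rfl

/-- `‖psi π x‖ = 1`. [folklore] -/
theorem norm_psi (π : 𝓞 K3) (x : 𝓞 K3 ⧸ Ideal.span ({π} : Set (𝓞 K3))) : ‖psi π x‖ = 1 := by
  rw [psi_apply_eq, norm_e]

/-- `psi⁻¹ x = conj (psi x)`. [folklore] -/
theorem psi_inv_apply (π : 𝓞 K3) (x : 𝓞 K3 ⧸ Ideal.span ({π} : Set (𝓞 K3))) :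
    (psi π)⁻¹ x = conj (psi π x) := by
  rw [AddChar.inv_apply]
  obtain ⟨d, rfl⟩ := Ideal.Quotient.mk_surjective x
  rw [← map_neg, psi_mk, psi_mk]
  push_cast
  rw [neg_div, e_neg]

/-- **`g(π)` is the Gauss sum of `(χ_π, ψ_π)`** in Mathlib's sense. [folklore] -/
theorem gauss_eq_gaussSum (hπ : Prime π) (hπ3 : (3 : 𝓞 K3) ∉ Ideal.span ({π} : Set (𝓞 K3))) [Fintype (𝓞 K3 ⧸ Ideal.span ({π} : Set (𝓞 K3)))] :
    gauss π = gaussSum (chi hπ hπ3) (psi π) := by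
  unfold gauss gaussSum
  rw [finsum_eq_sum_of_fintype]
  refine Finset.sum_congr rfl fun x _ ↦ ?_
  unfold gaussTerm
  rw [← chi_mk hπ hπ3, Ideal.Quotient.mk_out, psi_apply_eq]

/-- `g(χ⁻¹, ψ⁻¹) = conj g(χ, ψ)` for these characters. [folklore] -/
theorem gaussSum_inv_inv (hπ : Prime π) (hπ3 : (3 : 𝓞 K3) ∉ Ideal.span ({π} : Set (𝓞 K3))) [Fintype (𝓞 K3 ⧸ Ideal.span ({π} : Set (𝓞 K3)))] :
    gaussSum (chi hπ hπ3)⁻¹ (psi π)⁻¹ = conj (gaussSum (chi hπ hπ3) (psi π)) := by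
  unfold gaussSum
  rw [map_sum]
  refine Finset.sum_congr rfl fun x _ ↦ ?_
  rw [map_mul, chi_inv_apply, psi_inv_apply]

/-- The inverse of `a + bζ ≠ 0` in coordinates: `(a + bζ)⁻¹ = ((a − b) − bζ)/n`, `n = a² − ab + b²`.
[folklore] -/
theorem coe_mkInt_inv {a b : ℤ} (hn : (a ^ 2 - a * b + b ^ 2 : ℤ) ≠ 0) :
    (((mkInt a b : 𝓞 K3) : K3))⁻¹ =
      ⟨((a - b : ℤ) : ℚ) / (a ^ 2 - a * b + b ^ 2 : ℤ), ((-b : ℤ) : ℚ) / (a ^ 2 - a * b + b ^ 2 : ℤ)⟩ := by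
  have hn' : ((a ^ 2 - a * b + b ^ 2 : ℤ) : ℚ) ≠ 0 := by exact_mod_cast hn
  rw [coe_mkInt]
  refine inv_eq_of_mul_eq_one_right ?_
  have hnq : (a : ℚ) ^ 2 - a * b + b ^ 2 ≠ 0 := by exact_mod_cast hn
  ext
  · simp [QuadraticAlgebra.re_one]
    have h : ((a : ℚ) * (a - b) + b * b) / ((a : ℚ) ^ 2 - a * b + b ^ 2) = 1 := by
      rw [div_eq_one_iff_eq hnq]; ring
    convert h using 1
    ring
  · simp [QuadraticAlgebra.im_one]
    ring

/-- `Re (embC (x + yζ)) = x − y/2`. [folklore] -/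
theorem re_embC_mk (x y : ℚ) : (embC (⟨x, y⟩ : K3)).re = x - y / 2 := by
  rw [embC_mk]; simp [w_re]; ring

/-- `e(z) = 1` forces `2 Re z ∈ ℤ`. [folklore] -/
theorem exists_int_of_e_eq_one {z : K3} (h : e z = 1) : ∃ k : ℤ, 2 * (embC z).re = k := by
  rw [e_eq_exp_ofReal, Complex.exp_eq_one_iff] at h
  obtain ⟨k, hk⟩ := h
  refine ⟨k, ?_⟩
  have h' : ((2 * Real.pi * (2 * (embC z).re) : ℝ) : ℂ) * Complex.I =
      ((k * (2 * Real.pi) : ℝ) : ℂ) * Complex.I := by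
    rw [hk]; push_cast; ring
  have h'' := mul_right_cancel₀ Complex.I_ne_zero h'
  have h3 : (2 * (embC z).re) * (2 * Real.pi) = k * (2 * Real.pi) := by
    have : 2 * Real.pi * (2 * (embC z).re) = k * (2 * Real.pi) := by exact_mod_cast h''
    linarith
  exact mul_right_cancel₀ Real.two_pi_pos.ne' h3

/-- **`ψ_π` is non-trivial** for a prime `π ∤ 3`: if `e(1/π) = e(ζ/π) = 1` then, with `π = a + bζ`,
`n = N(π)` divides `2a − b` and `2b − a`, hence `3a` and `3b`, hence `n ∣ 9`, so `π ∣ 3`. [folklore] -/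
theorem psi_ne_one (hπ : Prime π) (hπ3 : (3 : 𝓞 K3) ∉ Ideal.span ({π} : Set (𝓞 K3))) : psi π ≠ 1 := by
  intro h
  obtain ⟨a, b, hab⟩ := exists_eq_mkInt π
  have hπ0 : π ≠ 0 := hπ.ne_zero
  have hn0 : (a ^ 2 - a * b + b ^ 2 : ℤ) ≠ 0 := by
    intro h0
    apply hπ0
    rw [hab, mkInt_eq_zero_iff]
    exact (norm_int_eq_zero_iff a b).mp h0
  have hnq : ((a ^ 2 - a * b + b ^ 2 : ℤ) : ℚ) ≠ 0 := by exact_mod_cast hn0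
  have hval : ∀ d : 𝓞 K3, e (((d : 𝓞 K3) : K3) / ((π : 𝓞 K3) : K3)) = 1 := by
    intro d
    rw [← psi_mk, h, AddChar.one_apply]
  have hinv := coe_mkInt_inv (a := a) (b := b) hn0
  -- `e(1/π) = 1`: `(2a − b)/n ∈ ℤ`
  have h1 := hval 1
  rw [show ((1 : 𝓞 K3) : K3) = 1 from map_one (algebraMap (𝓞 K3) K3), one_div, hab, hinv] at h1
  obtain ⟨k1, hk1⟩ := exists_int_of_e_eq_one h1
  rw [re_embC_mk] at hk1
  have hnr : (a : ℝ) ^ 2 - a * b + b ^ 2 ≠ 0 := by exact_mod_cast hn0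
  have hk1' : (2 * a - b : ℤ) = k1 * (a ^ 2 - a * b + b ^ 2) := by
    have hq : (2 * (a : ℝ) - b) / ((a : ℝ) ^ 2 - a * b + b ^ 2) = k1 := by
      rw [← hk1]; push_cast; ring
    rw [div_eq_iff hnr] at hq
    exact_mod_cast hq
  -- `e(ζ/π) = 1`: `(2b − a)/n ∈ ℤ`
  have h2 := hval zetaInt
  have hmul : (⟨0, 1⟩ : K3) *
      ⟨((a - b : ℤ) : ℚ) / (a ^ 2 - a * b + b ^ 2 : ℤ), ((-b : ℤ) : ℚ) / (a ^ 2 - a * b + b ^ 2 : ℤ)⟩ =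
      ⟨(b : ℚ) / (a ^ 2 - a * b + b ^ 2 : ℤ), (a : ℚ) / (a ^ 2 - a * b + b ^ 2 : ℤ)⟩ := by
    ext
    · simp; ring
    · simp; ring
  rw [div_eq_mul_inv, hab, hinv, coe_zetaInt, zeta_eq, hmul] at h2
  obtain ⟨k2, hk2⟩ := exists_int_of_e_eq_one h2
  rw [re_embC_mk] at hk2
  have hk2' : (2 * b - a : ℤ) = k2 * (a ^ 2 - a * b + b ^ 2) := by
    have hq : (2 * (b : ℝ) - a) / ((a : ℝ) ^ 2 - a * b + b ^ 2) = k2 := by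
      rw [← hk2]; push_cast; ring
    rw [div_eq_iff hnr] at hq
    exact_mod_cast hq
  -- `n ∣ 3a`, `n ∣ 3b`, so `n ∣ 9`
  have h3a : (a ^ 2 - a * b + b ^ 2 : ℤ) ∣ 3 * a := ⟨2 * k1 + k2, by linear_combination 2 * hk1' + hk2'⟩
  have h3b : (a ^ 2 - a * b + b ^ 2 : ℤ) ∣ 3 * b := ⟨k1 + 2 * k2, by linear_combination hk1' + 2 * hk2'⟩
  have hn9 : (a ^ 2 - a * b + b ^ 2 : ℤ) ∣ 9 := by
    have h9n : (a ^ 2 - a * b + b ^ 2) * (a ^ 2 - a * b + b ^ 2) ∣ 9 * (a ^ 2 - a * b + b ^ 2) := by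
      have : 9 * (a ^ 2 - a * b + b ^ 2) = (3 * a) * (3 * a) - (3 * a) * (3 * b) + (3 * b) * (3 * b) := by ring
      rw [this]
      exact dvd_add (dvd_sub (mul_dvd_mul h3a h3a) (mul_dvd_mul h3a h3b)) (mul_dvd_mul h3b h3b)
    exact (mul_dvd_mul_iff_right hn0).mp h9n
  -- hence `π ∣ 9`, so `π ∣ 3`: contradiction
  have hπn : π ∣ ((a ^ 2 - a * b + b ^ 2 : ℤ) : 𝓞 K3) := by
    rw [hab, ← mkInt_mul_conj]
    exact dvd_mul_right _ _
  have hπ9 : π ∣ (9 : 𝓞 K3) := by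
    obtain ⟨c, hc⟩ := hn9
    have h9c : ((9 : ℤ) : 𝓞 K3) = ((a ^ 2 - a * b + b ^ 2 : ℤ) : 𝓞 K3) * (c : 𝓞 K3) := by
      rw [← Int.cast_mul, ← hc]
    rw [Int.cast_ofNat] at h9c
    rw [h9c]
    exact dvd_mul_of_dvd_left hπn _
  have hπ3' : π ∣ (3 : 𝓞 K3) := by
    have h9 : (9 : 𝓞 K3) = 3 * 3 := by norm_num
    rw [h9] at hπ9
    exact (hπ.dvd_or_dvd hπ9).elim id id
  exact hπ3 (Ideal.mem_span_singleton.mpr hπ3')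

/-- `ψ_π` is primitive (the residue ring is a field). [folklore] -/
theorem psi_isPrimitive (hπ : Prime π) (hπ3 : (3 : 𝓞 K3) ∉ Ideal.span ({π} : Set (𝓞 K3))) : (psi π).IsPrimitive := by
  haveI : (Ideal.span ({π} : Set (𝓞 K3))).IsMaximal := (primeOf hπ).isMaximal
  letI := Ideal.Quotient.field (Ideal.span ({π} : Set (𝓞 K3)))
  exact AddChar.IsPrimitive.of_ne_one (psi_ne_one hπ hπ3)

/-- `#(𝓞 K3 ⧸ (π)) = N(π)`. [folklore] -/
theorem card_quotient_eq (π : 𝓞 K3) [Fintype (𝓞 K3 ⧸ Ideal.span ({π} : Set (𝓞 K3)))] :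
    Fintype.card (𝓞 K3 ⧸ Ideal.span ({π} : Set (𝓞 K3))) =
      Ideal.absNorm (Ideal.span ({π} : Set (𝓞 K3))) := by
  rw [Ideal.absNorm_apply, Submodule.cardQuot_apply, Nat.card_eq_fintype_card]

/-- **`|g(π)|² = N(π)`** for a prime `π ∤ 3` of `ℤ[ω]` (Heath-Brown–Patterson p. 111: "`|g(c)| = |c|`"
for square-free `c`). [cite: HeathBrownPatterson1979, p.111; IrelandRosen1990, Prop. 8.2.2] -/
theorem norm_gauss_sq (hπ : Prime π) (hπ3 : (3 : 𝓞 K3) ∉ Ideal.span ({π} : Set (𝓞 K3))) :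
    ‖gauss π‖ ^ 2 = Ideal.absNorm (Ideal.span ({π} : Set (𝓞 K3))) := by
  haveI : (Ideal.span ({π} : Set (𝓞 K3))).IsMaximal := (primeOf hπ).isMaximal
  letI := Ideal.Quotient.field (Ideal.span ({π} : Set (𝓞 K3)))
  haveI : NeZero π := ⟨hπ.ne_zero⟩
  letI : Fintype (𝓞 K3 ⧸ Ideal.span ({π} : Set (𝓞 K3))) := Fintype.ofFinite _
  have h := gaussSum_mul_gaussSum_eq_card (chi_ne_one hπ hπ3) (psi_isPrimitive hπ hπ3)
  rw [gaussSum_inv_inv hπ hπ3, Complex.mul_conj, card_quotient_eq, ← gauss_eq_gaussSum hπ hπ3] at h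
  rw [← Complex.normSq_eq_norm_sq]
  exact_mod_cast h

/-- **`|g̃(π)| = 1`** for a prime `π ∤ 3`. [cite: HeathBrownPatterson1979, p.111] -/
theorem norm_gaussTilde (hπ : Prime π) (hπ3 : (3 : 𝓞 K3) ∉ Ideal.span ({π} : Set (𝓞 K3))) : ‖gaussTilde π‖ = 1 := by
  unfold gaussTilde
  have hN : 0 < (Ideal.absNorm (Ideal.span ({π} : Set (𝓞 K3))) : ℝ) := by
    have : Ideal.absNorm (Ideal.span ({π} : Set (𝓞 K3))) ≠ 0 := by
      rw [Ne, Ideal.absNorm_eq_zero_iff, Ideal.span_singleton_eq_bot]; exact hπ.ne_zero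
    exact_mod_cast Nat.pos_of_ne_zero this
  rw [norm_div, Complex.norm_real, Real.norm_of_nonneg (Real.sqrt_nonneg _), div_eq_one_iff_eq
    (Real.sqrt_pos.mpr hN).ne']
  rw [← Real.sqrt_sq (norm_nonneg (gauss π)), norm_gauss_sq hπ hπ3]

end Prime

/-- `‖g̃(π)‖ ≤ 1` for every prime `π` (the bound used on the inert primes). [folklore] -/
theorem norm_gaussTilde_le_one {π : 𝓞 K3} (hπ : Prime π) (hπ1 : π - 1 ∈ three) : ‖gaussTilde π‖ ≤ 1 :=
  (norm_gaussTilde hπ (three_not_mem_span_of_sub_one_mem hπ hπ1)).le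

/-! ### Conjugation: `g(π̄) = conj g(π)` -/

section Conj

variable {π : 𝓞 K3}

/-- `τ π` is prime. [folklore] -/
theorem prime_tau (hπ : Prime π) : Prime (tau π) := (MulEquiv.prime_iff tau.toMulEquiv).mpr hπ

/-- `τ π ∤ 3`. [folklore] -/
theorem three_not_mem_span_tau (hπ3 : (3 : 𝓞 K3) ∉ Ideal.span ({π} : Set (𝓞 K3))) :
    (3 : 𝓞 K3) ∉ Ideal.span ({tau π} : Set (𝓞 K3)) := by
  intro h
  apply hπ3
  rw [Ideal.mem_span_singleton] at h ⊢
  obtain ⟨c, hc⟩ := h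
  refine ⟨tau c, ?_⟩
  have := congrArg tau hc
  rwa [tau_three, map_mul, tau_tau] at this

/-- The residue-ring isomorphism `𝓞 K3 ⧸ (π) ≃ 𝓞 K3 ⧸ (τ π)` induced by `τ`. [folklore] -/
def quotTau (π : 𝓞 K3) :
    𝓞 K3 ⧸ Ideal.span ({π} : Set (𝓞 K3)) ≃+* 𝓞 K3 ⧸ Ideal.span ({tau π} : Set (𝓞 K3)) :=
  Ideal.quotientEquiv _ _ tau (map_tau_span π).symm

/-- `quotTau (mk d) = mk (τ d)`. [folklore] -/
theorem quotTau_mk (π d : 𝓞 K3) :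
    quotTau π (Ideal.Quotient.mk _ d) = Ideal.Quotient.mk _ (tau d) :=
  Ideal.quotientEquiv_mk _ _ tau (map_tau_span π).symm d

/-- **Naturality of the cubic character**: `χ_{τπ}(τ x) = conj χ_π(x)`. [cite: IrelandRosen1990, Prop. 9.3.4] -/
theorem chi_tau_quotTau (hπ : Prime π) (hπ3 : (3 : 𝓞 K3) ∉ Ideal.span ({π} : Set (𝓞 K3))) (x : 𝓞 K3 ⧸ Ideal.span ({π} : Set (𝓞 K3))) :
    chi (prime_tau hπ) (three_not_mem_span_tau hπ3) (quotTau π x) = conj (chi hπ hπ3 x) := by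
  obtain ⟨d, rfl⟩ := Ideal.Quotient.mk_surjective x
  rw [quotTau_mk, chi_apply, chi_apply]
  have hconj : conjPrime (primeOf hπ) = primeOf (prime_tau hπ) := conjPrime_primeOf hπ (prime_tau hπ)
  have key := cubicResidueSymbol_conjPrime (primeOf hπ) hπ3 d
  rw [hconj] at key
  -- `key` is stated with `Ideal.Quotient.mk (primeOf _).asIdeal`, definitionally our quotient maps
  have key' : cubicResidueSymbol (primeOf (prime_tau hπ))
      (Ideal.Quotient.mk (Ideal.span ({tau π} : Set (𝓞 K3))) (tau d)) =
      tau (cubicResidueSymbol (primeOf hπ) (Ideal.Quotient.mk (Ideal.span ({π} : Set (𝓞 K3))) d)) := key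
  rw [key', embC_tau]

/-- `ψ_{τπ}(τ x) = ψ_π(x)` (`e(z̄) = e(z)`). [folklore] -/
theorem psi_tau_quotTau (π : 𝓞 K3) (x : 𝓞 K3 ⧸ Ideal.span ({π} : Set (𝓞 K3))) :
    psi (tau π) (quotTau π x) = psi π x := by
  obtain ⟨d, rfl⟩ := Ideal.Quotient.mk_surjective x
  rw [quotTau_mk, psi_mk, psi_mk, coe_tau, coe_tau, ← star_div₀, e_star]

/-- `χ(−1) = 1` for a cubic character. [folklore] -/
theorem chi_neg_one (hπ : Prime π) (hπ3 : (3 : 𝓞 K3) ∉ Ideal.span ({π} : Set (𝓞 K3))) : chi hπ hπ3 (-1) = 1 := by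
  have h3 : chi hπ hπ3 (-1) ^ 3 = 1 := by
    rcases chi_eq_zero_or_pow_three hπ hπ3 (-1) with h | h
    · exfalso
      have : chi hπ hπ3 ((-1) * (-1)) = 0 := by rw [map_mul, h, zero_mul]
      rw [neg_one_mul, neg_neg, map_one] at this
      exact one_ne_zero this
    · exact h
  have h2 : chi hπ hπ3 (-1) ^ 2 = 1 := by
    rw [← map_pow, neg_one_sq, map_one]
  calc chi hπ hπ3 (-1) = chi hπ hπ3 (-1) ^ 3 / chi hπ hπ3 (-1) ^ 2 := by
        rw [h2, div_one, pow_succ, h2, one_mul]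
    _ = 1 := by rw [h3, h2, div_one]

/-- **`g(π̄) = conj g(π)`** (Heath-Brown–Patterson p. 115: "`g(c̄) = conj g(c)`"), for a prime
`π ∤ 3`. [cite: HeathBrownPatterson1979, §2 p.115] -/
theorem gauss_tau (hπ : Prime π) (hπ3 : (3 : 𝓞 K3) ∉ Ideal.span ({π} : Set (𝓞 K3))) : gauss (tau π) = conj (gauss π) := by
  haveI : (Ideal.span ({π} : Set (𝓞 K3))).IsMaximal := (primeOf hπ).isMaximal
  letI := Ideal.Quotient.field (Ideal.span ({π} : Set (𝓞 K3)))
  haveI : NeZero π := ⟨hπ.ne_zero⟩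
  haveI : NeZero (tau π) := ⟨(prime_tau hπ).ne_zero⟩
  letI : Fintype (𝓞 K3 ⧸ Ideal.span ({π} : Set (𝓞 K3))) := Fintype.ofFinite _
  letI : Fintype (𝓞 K3 ⧸ Ideal.span ({tau π} : Set (𝓞 K3))) := Fintype.ofFinite _
  rw [gauss_eq_gaussSum (prime_tau hπ) (three_not_mem_span_tau hπ3), gauss_eq_gaussSum hπ hπ3,
    ← gaussSum_inv_inv hπ hπ3]
  -- `g(χ⁻¹, ψ⁻¹) = χ⁻¹(−1) g(χ⁻¹, ψ) = g(χ⁻¹, ψ)`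
  rw [← mul_gaussSum_inv_eq_gaussSum (chi hπ hπ3)⁻¹ (psi π)⁻¹, inv_inv, chi_inv_apply, chi_neg_one,
    map_one, one_mul]
  -- reindex the Gauss sum over `τ`
  unfold gaussSum
  rw [← Fintype.sum_equiv (quotTau π).toEquiv _ _ (fun x ↦ rfl)]
  refine Finset.sum_congr rfl fun x _ ↦ ?_
  rw [RingEquiv.toEquiv_eq_coe, EquivLike.coe_coe, chi_tau_quotTau hπ hπ3, psi_tau_quotTau,
    chi_inv_apply]

/-- **`g̃(τ π) = conj g̃(π)`.** [cite: HeathBrownPatterson1979, §2 p.115] -/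
theorem gaussTilde_tau (hπ : Prime π) (hπ3 : (3 : 𝓞 K3) ∉ Ideal.span ({π} : Set (𝓞 K3))) : gaussTilde (tau π) = conj (gaussTilde π) := by
  unfold gaussTilde
  have hN : Ideal.absNorm (Ideal.span ({tau π} : Set (𝓞 K3))) = Ideal.absNorm (Ideal.span ({π} : Set (𝓞 K3))) := by
    rw [← map_tau_span]
    have := residueCard_conjPrime (primeOf hπ)
    simpa [HeightOneSpectrum.residueCard, conjPrime_asIdeal, primeOf_asIdeal] using this
  rw [hN, gauss_tau hπ hπ3, map_div₀, Complex.conj_ofReal]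

end Conj

end HeathBrownPatterson

end Literature.NumberTheory.GaussSums
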